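import Summits.AtomisticToContinuum.Crystallization.Theorems.FrustratedLawDichotomyCoherentOn

/-!
# FrustratedLawDichotomy · crux `AperiodicFrustratedLawGap` (stmt-AtomisticToContinuum-27623) — INHABITATION OF COHERENT ROWS BY COMPLETE TEMPLATES
(cell decomp-a2c, lens-5 g114; crit r1861 (A)(E2): «inhabitation must be a Lean fact»; KFILE amendment E)

The generic non-vacuity certificate for a coherent row.  A configuration `L ⊆ E3` (counting measure `count⌊L`) lies in
`coherentOn (M.image pos) τ W` — in particular in `coherentAt (M.image pos) τ Rc` — as soon as
(1) every template point is an atom: `pos m ∈ L` for `m ∈ M` (`τ ≥ 0`), and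
(2) COMPLETENESS: every atom of `L` inside the window IS a template point: `∀ q ∈ L, q ∈ W → ∃ m ∈ M, q = pos m`.
For a lattice row of record (amendment E, E2: template = every admissible label `z` with `(1 − 3ε)|Tz|² ≤ (Rc + τ)²`) and the exact lattice `L = T·ℤ³_adm`
at the strain `F = 1`, (1) is tautological and (2) is the real inequality `|Tz|² ≤ Rc² ⇒ (1 − 3ε)|Tz|² ≤ (Rc + τ)²` plus the label cube bound — so a
K-file's `rowCell_…_inhabited` theorem is `count_restrict_mem_coherentAt_of_complete` applied to two `norm_num` facts (no enumeration).
The old rows of record (template = tubes inside the window for every strain) fail (2) at ≥ 60 sites and admit NO such witness.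

House conventions: SI units · italic scalars, bold vectors, sans-serif tensors · numbered formulae only when referenced · en-dash for ranges ·
References = cited works, numbered, alphabetical · no footnotes; Remarks at section ends · British spelling, -ise · Lennard-Jones hyphenated; NASH
capitalised as the Statement's notion · "folklore" tags standard bookkeeping; no new references are cited in this file.
0 defs · 0 sorry · imports the tree's `…CoherentOn` only.
-/

noncomputable section

namespace Summit.AtomisticToContinuum.Crystallization.Theorems.FrustratedLawDichotomyCoherentInhabited

open MeasureTheory Metric Set
open scoped ENNReal
open Summit.AtomisticToContinuum.Crystallization.Theorems.ChargedEnergyGapNegative (E3)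
open Summit.AtomisticToContinuum.Crystallization.Theorems.FrustratedLawDichotomyCoherentSets (coherentAt mem_coherentAt_iff)
open Summit.AtomisticToContinuum.Crystallization.Theorems.FrustratedLawDichotomyCoherentOn

variable {ι : Type*}

/-- An atom of `L` gives its closed `τ`-ball positive `count⌊L`-mass (`τ ≥ 0`). [folklore] -/
theorem count_restrict_closedBall_ne_zero {L : Set E3} {x : E3} (hx : x ∈ L) {τ : ℝ} (hτ : 0 ≤ τ) :
    (Measure.count.restrict L : Measure E3) (closedBall x τ) ≠ 0 := by
  have h1 : (Measure.count.restrict L : Measure E3) {x} ≠ 0 :=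
    (Literature.Probability.Process.count_restrict_singleton_ne_zero_iff L x).mpr hx
  have h2 : ({x} : Set E3) ⊆ closedBall x τ := singleton_subset_iff.mpr (mem_closedBall_self hτ)
  exact fun h => h1 (le_antisymm ((measure_mono h2).trans h.le) zero_le)

/-- `count⌊L` vanishes on a measurable set that misses `L`. [folklore] -/
theorem count_restrict_eq_zero_of_disjoint {L A : Set E3} (hA : MeasurableSet A) (h : ∀ q ∈ L, q ∉ A) :
    (Measure.count.restrict L : Measure E3) A = 0 := by
  rw [Measure.restrict_apply hA]
  have he : A ∩ L = ∅ := Set.eq_empty_iff_forall_notMem.mpr fun q hq => h q hq.2 hq.1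
  rw [he, measure_empty]

/-- ★ **INHABITATION OF A COHERENT ROW, general window.**  If every template point is an atom of `L` and every atom of `L` in the window `W` is a
template point, then `count⌊L ∈ coherentOn (M.image pos) τ W` (`τ ≥ 0`, `W` measurable). [folklore] -/
theorem count_restrict_mem_coherentOn_of_complete (M : Finset ι) (pos : ι → E3) {L W : Set E3} (hW : MeasurableSet W) {τ : ℝ} (hτ : 0 ≤ τ)
    (hML : ∀ m ∈ M, pos m ∈ L) (hcomp : ∀ q ∈ L, q ∈ W → ∃ m ∈ M, q = pos m) :
    (Measure.count.restrict L : Measure E3) ∈ coherentOn (M.image pos) τ W := by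
  classical
  rw [mem_coherentOn_iff]
  refine ⟨fun x hx => ?_, ?_⟩
  · obtain ⟨m, hm, rfl⟩ := Finset.mem_image.mp hx
    exact count_restrict_closedBall_ne_zero (hML m hm) hτ
  · refine count_restrict_eq_zero_of_disjoint (measurableSet_window_diff' (M.image pos) τ hW) fun q hq hqA => ?_
    obtain ⟨hqW, hqU⟩ := hqA
    obtain ⟨m, hm, rfl⟩ := hcomp q hq hqW
    exact hqU (Set.mem_biUnion (Finset.mem_coe.mpr (Finset.mem_image_of_mem pos hm)) (mem_closedBall_self hτ))

/-- ★ **INHABITATION OF A COHERENT ROW, ball window** (`coherentAt`). [folklore] -/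
theorem count_restrict_mem_coherentAt_of_complete (M : Finset ι) (pos : ι → E3) {L : Set E3} {τ Rc : ℝ} (hτ : 0 ≤ τ)
    (hML : ∀ m ∈ M, pos m ∈ L) (hcomp : ∀ q ∈ L, ‖q‖ ≤ Rc → ∃ m ∈ M, q = pos m) :
    (Measure.count.restrict L : Measure E3) ∈ coherentAt (M.image pos) τ Rc := by
  rw [coherentAt_eq_coherentOn]
  exact count_restrict_mem_coherentOn_of_complete M pos measurableSet_closedBall hτ hML
    fun q hq hqW => hcomp q hq (mem_closedBall_zero_iff.mp hqW)

/-- ★ THE LATTICE FORM (what a K-file proves): labels `κ`, an admissibility predicate `adm`, positions `pos : κ → E3`, the row's finite template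
`M`, the exact configuration `L = pos '' {z | adm z}`.  If `M ⊆ adm` and every admissible label whose point lies in the window is in `M`
(COMPLETENESS of the template — amendment E's rule), the exact configuration inhabits the row. [folklore] -/
theorem image_mem_coherentAt_of_complete {κ : Type*} (adm : κ → Prop) (pos : κ → E3) (M : Finset κ) {τ Rc : ℝ} (hτ : 0 ≤ τ)
    (hM : ∀ m ∈ M, adm m) (hcomp : ∀ z, adm z → ‖pos z‖ ≤ Rc → z ∈ M) :
    (Measure.count.restrict (pos '' {z | adm z}) : Measure E3) ∈ coherentAt (M.image pos) τ Rc :=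
  count_restrict_mem_coherentAt_of_complete M pos hτ (fun m hm => ⟨m, hM m hm, rfl⟩) fun q hq hqR => by
    obtain ⟨z, hz, rfl⟩ := hq
    exact ⟨z, hcomp z hz hqR, rfl⟩

/-- The same on a general window (halo / zone rows): completeness is asked only of admissible labels whose point lies in `W`. [folklore] -/
theorem image_mem_coherentOn_of_complete {κ : Type*} (adm : κ → Prop) (pos : κ → E3) (M : Finset κ) {W : Set E3} (hW : MeasurableSet W)
    {τ : ℝ} (hτ : 0 ≤ τ) (hM : ∀ m ∈ M, adm m) (hcomp : ∀ z, adm z → pos z ∈ W → z ∈ M) :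
    (Measure.count.restrict (pos '' {z | adm z}) : Measure E3) ∈ coherentOn (M.image pos) τ W :=
  count_restrict_mem_coherentOn_of_complete M pos hW hτ (fun m hm => ⟨m, hM m hm, rfl⟩) fun q hq hqW => by
    obtain ⟨z, hz, rfl⟩ := hq
    exact ⟨z, hcomp z hz hqW, rfl⟩

/-- ★ THE OBSTRUCTION (why the old rows were empty): if some atom of `L` lies in the window but in NO template tube, `count⌊L` is not in the row —
for the ed2 templates every near-perfect lattice has ≥ 60 such atoms at `r ≈ Rc`. [folklore] -/
theorem count_restrict_not_mem_coherentOn (a : Finset E3) {L W : Set E3} {τ : ℝ} {q : E3} (hq : q ∈ L) (hqW : q ∈ W)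
    (hfar : ∀ x ∈ a, τ < dist q x) : (Measure.count.restrict L : Measure E3) ∉ coherentOn a τ W := by
  intro h
  rw [mem_coherentOn_iff] at h
  have hqA : q ∈ W \ ⋃ x ∈ a, closedBall x τ := by
    refine ⟨hqW, fun hU => ?_⟩
    simp only [mem_iUnion, exists_prop] at hU
    obtain ⟨x, hx, hqx⟩ := hU
    exact absurd (mem_closedBall.mp hqx) (not_le.mpr (hfar x hx))
  have h1 : (Measure.count.restrict L : Measure E3) {q} ≠ 0 :=
    (Literature.Probability.Process.count_restrict_singleton_ne_zero_iff L q).mpr hq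
  exact h1 (le_antisymm ((measure_mono (singleton_subset_iff.mpr hqA)).trans h.2.le) zero_le)

end Summit.AtomisticToContinuum.Crystallization.Theorems.FrustratedLawDichotomyCoherentInhabited

end
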